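import Literature.NumberTheory.Irrationality.Zudilin2003.CatalanSeries
import Literature.NumberTheory.Irrationality.Zudilin2003.InclusionsArith
import Literature.NumberTheory.Irrationality.Zudilin2003.ContinuedFraction
import HarnessLib

/-!
# Zudilin 2003, Theorem 1 PROVED (all clauses) and Theorem 2 PROVED

Source: W. Zudilin, *An Apéry-like difference equation for Catalan's constant*, Electron. J. Combin.
10 (2003), #R14, arXiv:math/0201024 [Zudilin2003Catalan], Theorem 1 and Theorem 2 (Sect. 1), with the
proof of Sect. 2 (Lemma 1, inclusions (16); Lemma 5).

HONEST FRAMING (cell `pub-zeta5`): systematic search; no irrationality claim unless certified.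

This file closes the two named facts of `CatalanRecursion.lean` / `ContinuedFraction.lean`:

* `u_inclusion`, `v_inclusion` — **the inclusions (5)**: `2^{4n+3} D_n u_n ∈ ℤ` and
  `2^{4n+3} D_{2n-1}³ v_n ∈ ℤ` for every `n`. Proof as printed: `8u_n = U_n' = 4 Σ_k (-1)^k A_{1k}(n)`
  and `8v_n = V_n` (Lemma 5, `CatalanSeries`: `U_values`, `V_eq`, over THE partial-fraction data `pf n` of
  (17)), the data are `16^{-n}` times the integer-residue brick data of `BrickDecomposition.exists_pf_R`
  (uniqueness `pf_eq_of_eval`), whose denominators are controlled by (16) (`BallRivoal.IsInt`) and by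
  `D_{2n-1}^s Σ_{l<k} (-1)^l/(l+½)^s ∈ ℤ` (`InclusionsArith`);
* `theorem1_holds : theorem1` — **Theorem 1 in full**: positivity (`CatalanRecursion`), the inclusions (5)
  (here), and the limit `v_n/u_n → G` (`CatalanSeries.tendsto_v_div_u`);
* `theorem2_holds : theorem2` — **Theorem 2** (the continued fraction for `G`), from
  `ContinuedFraction.theorem2_of_tendsto` and the limit.

Everything is PROVED (0 sorry); this discharges the named facts `Zudilin2003.theorem1` and
`Zudilin2003.theorem2` (the cited `Zudilin2003.rates` then follows in the cell's Summit file
`Zeta5Search/Zudilin2003ExactDecay.rates_of_theorem1`).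
-/

noncomputable section

open Finset Filter
open scoped _root_.Topology

namespace Literature.NumberTheory.Irrationality.Zudilin2003

open Literature.NumberTheory.Transcendental

/-! ### The brick data are `16ⁿ ×` THE partial-fraction data -/

/-- For `n ≥ 1`: integer-residue brick data `c` of `16ⁿ R_n(τ+½)` (`BrickDecomposition.exists_pf_R_lcmUpto`)
coincide with `16ⁿ · pf n` on the support (uniqueness of partial fractions).
[cite: Zudilin2003Catalan, Sect. 2, Lemma 1, eqs. (16)–(17)] -/
theorem exists_int_data (n : ℕ) (hn : 1 ≤ n) :
    ∃ c : ℕ → ℕ → ℚ, BallRivoal.IsInt 3 (Nat.lcmUpto n) c ∧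
      ∀ o p, o < 3 → p ≤ n → c o p = (16 : ℚ) ^ n * pf n o p := by
  obtain ⟨c, hc, hint⟩ := exists_pf_R_lcmUpto n hn
  refine ⟨c, hint, fun o p ho hp => ?_⟩
  have h16 : ((16 : ℚ) ^ n) ≠ 0 := by positivity
  have h := pf_eq_of_eval n (fun o p => ((16 : ℚ) ^ n)⁻¹ * c o p) (fun k => by
    rw [BallRivoal.pfEval_const_mul, hc k (fun p _ => by positivity), inv_mul_cancel_left₀ h16]) o p ho hp
  rw [← h, mul_inv_cancel_left₀ h16]

/-! ### The inclusions (5) -/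

/-- **`2^{4n+3} D_n u_n ∈ ℤ`** (first inclusion of (5)). [cite: Zudilin2003Catalan, Theorem 1, eq. (5)] -/
theorem u_inclusion (n : ℕ) : ∃ z : ℤ, (z : ℚ) = 2 ^ (4 * n + 3) * (Nat.lcmUpto n : ℚ) * u n := by
  rcases Nat.eq_zero_or_pos n with rfl | hn
  · refine ⟨8, ?_⟩
    rw [u, sol_zero]
    norm_num [Nat.lcmUpto]
  obtain ⟨c, hint, hc⟩ := exists_int_data n hn
  obtain ⟨z, hz⟩ := isInt_dpow_mul_altSum n (Nat.lcmUpto n) c hint 1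
  refine ⟨4 * z, ?_⟩
  -- `8 u_n = U_n' = 4 coefAlt n 1 = 4 Σ_p (-1)^p pf n 1 p`, `16ⁿ pf = c`
  have hU := (U_values n).2.2
  rw [U2, coefAlt] at hU
  have hsum : ∑ p ∈ range (n + 1), (-1 : ℚ) ^ p * c 1 p
      = (16 : ℚ) ^ n * ∑ p ∈ range (n + 1), (-1 : ℚ) ^ p * pf n 1 p := by
    rw [mul_sum]
    refine sum_congr rfl fun p hp => ?_
    rw [hc 1 p (by norm_num) (Nat.lt_succ_iff.1 (mem_range.1 hp))]
    ring
  rw [show (2 : ℕ) - 1 = 1 by rfl, pow_one, hsum] at hz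
  push_cast
  rw [← hz, show (2 : ℚ) ^ (4 * n + 3) = 8 * 16 ^ n by
    rw [pow_add, pow_mul]; norm_num; ring]
  linear_combination ((Nat.lcmUpto n : ℚ) * (16 : ℚ) ^ n) * hU

/-- **`2^{4n+3} D_{2n-1}³ v_n ∈ ℤ`** (second inclusion of (5)). [cite: Zudilin2003Catalan, Theorem 1, eq. (5)] -/
theorem v_inclusion (n : ℕ) :
    ∃ z : ℤ, (z : ℚ) = 2 ^ (4 * n + 3) * (Nat.lcmUpto (2 * n - 1) : ℚ) ^ 3 * v n := by
  rcases Nat.eq_zero_or_pos n with rfl | hn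
  · refine ⟨0, ?_⟩
    rw [v, sol_zero]
    simp
  obtain ⟨c, hint, hc⟩ := exists_int_data n hn
  obtain ⟨z, hz⟩ := isInt_lcmUpto_cube_mul_constTerm n hn c hint
  refine ⟨z, ?_⟩
  have hV := V_eq n
  rw [V] at hV
  have hsum : ∑ o ∈ range 3, ∑ k ∈ range (n + 1), (-1 : ℚ) ^ k * c o k * altHalfPartial (o + 1) k
      = (16 : ℚ) ^ n * ∑ o ∈ range 3, ∑ p ∈ range (n + 1), pf n o p * (-1) ^ p * harmAlt (o + 1) p := by
    rw [mul_sum]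
    refine sum_congr rfl fun o ho => ?_
    rw [mul_sum]
    refine sum_congr rfl fun p hp => ?_
    rw [hc o p (mem_range.1 ho) (Nat.lt_succ_iff.1 (mem_range.1 hp)), altHalfPartial, harmAlt]
    ring
  rw [hsum] at hz
  rw [← hz, show (2 : ℚ) ^ (4 * n + 3) = 8 * 16 ^ n by rw [pow_add, pow_mul]; norm_num; ring]
  linear_combination (((Nat.lcmUpto (2 * n - 1) : ℕ) : ℚ) ^ 3 * (16 : ℚ) ^ n) * hV

/-! ### Theorem 1 and Theorem 2 -/

/-- **Theorem 1 of [Zudilin2003Catalan], PROVED**: `u_n, v_n` are positive rationals (`v_0 = 0`) with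
`2^{4n+3}D_n u_n ∈ ℤ`, `2^{4n+3}D_{2n-1}³ v_n ∈ ℤ`, and `v_n/u_n → G`. Discharges the named fact `theorem1`.
[cite: Zudilin2003Catalan, Theorem 1] -/
theorem theorem1_holds : Zudilin2003.theorem1 :=
  ⟨fun n => ⟨(u_pos_and_v_succ_pos n).1, fun hn => v_pos hn, u_inclusion n, v_inclusion n⟩,
    tendsto_v_div_u⟩

/-- **Theorem 2 of [Zudilin2003Catalan], PROVED**: the convergents of
`13/2 / (q(0) + 1⁴2⁴p(0)p(2) / (q(1) + ⋯))` tend to `G`. Discharges the named fact `theorem2`.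
[cite: Zudilin2003Catalan, Theorem 2] -/
theorem theorem2_holds : Zudilin2003.theorem2 := theorem2_of_tendsto tendsto_v_div_u

end Literature.NumberTheory.Irrationality.Zudilin2003
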